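import Mathlib
import Summits.ValiantsHypothesis.ValiantsHypothesis.Theorems.GrenetZeonTwoDimCoefficientsDualJet
import Literature.Computability.AlgebraicComplexity.MignonRessayreBound
import HarnessLib

/-!
# Crux `GrenetZeon.PolySizeQPAlgebra` (stmt-ValiantsHypothesis-8064), line `vbp-slice-dealg` —
# the JET HESSIAN BOUND: `rank Hess(Σ_{j<r} λ_j [t^j] det M(t)) ≤ 2r·m` where the lower jets vanish

At the degree floor `m = n` of the `c = 1` box every `(n, s)`-witness of `per_n` is a sum of pieces
`λ(det_R L)` over LOCAL FROBENIUS algebras `R` with `L` linear (`…HomogeneousLocalForm`).  For a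
curvilinear piece `R = K[ε]/(ε^r)` (the only local Frobenius type in dimension `r ≤ 3`) write
`L = Σ_{a<r} ε^a A_a` and `λ(ε^j) = λ_j`: then `λ(det_R L) = Σ_{j<r} λ_j D_j` with
`D_j = [t^j] det(Σ_a t^a A_a)` the JETS of the determinant.  The Hessian engine of the route needs, at
suitable points `p`, a bound LINEAR in `m` on `rank Hess(Σ λ_j D_j)(p)`; the tree has it for `r = 1`
(`rank_hess0_det_le`: `2m` at a zero of `det`) and `r = 2` (`…DualJet`: `2m + 4m` at a common zero of
`det A₀`, `tr(adj A₀ · A₁)` … of `det A₀` and the form).  This file proves the bound for EVERY `r`, in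
polynomial-matrix currency (no new definitions): for an `m × m` matrix `M` over `S[t]`,
`S = K[x_σ]`, whose coefficient matrices `A_a = [t^a] M` have affine entries,

* `rank_hess0_jet_le` — **if the jets `D_0, …, D_{r-2}` and the form `f = Σ_{j<r} λ_j D_j` vanish at
  the origin, then `rank Hess f(0) ≤ r · 2m`**; `rank_hess0_transl_jet_le` — the same at any point.
  (`r = 2` IMPROVES the dual count of `…DualJet` from `6m` to `4m` for the combination
  `λ₀ det A₀ + λ₁ tr(adj A₀ · A₁)`; `r = 3` is the type `ℂ[ε]/ε³` of the rung `(n, 3)`.)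

Proof (induction on `r`, the shift trick).  Left-normalise by a constant invertible matrix so that
row `i₀` of `A₀` vanishes at `0` (possible since `D_0(0) = det A₀(0) = 0` once `r ≥ 2`; the jets only
rescale).  Laplace along row `i₀` with `M_{i₀k} = a_k + t·M'_{i₀k}` (`a_k = A₀{}_{i₀k}`,
`M' = divX`) and multilinearity give the identity
`det M = Σ_k a_k · adj(M)_{k i₀} + t · det B`, `B := M` with row `i₀` replaced by `M'_{i₀}`
(`det_eq_sum_C_coeff_zero_mul_adjugate_add_X_mul`), i.e. `D_j(M) = Σ_k a_k(…) + D_{j-1}(B)`: the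
jets of `M` are those of `B` SHIFTED BY ONE plus multiples of the `a_k`, which vanish at `0`.  Hence
`f_M = Σ_k a_k Ψ_k + f_B` with `f_B = Σ_{j<r-1} λ_{j+1} D_j(B)` a jet form of order `r - 1` satisfying
the same hypotheses (`jet_row_expansion`); `Σ_k a_k Ψ_k` has Hessian rank `≤ 2m` (symmetrised rank
one per `k`, `rank_hess0_mul_le_two`), and induction gives `2m + (r-1)·2m`.  The base `r = 1` is
`rank_hess0_det_le` (Mignon–Ressayre).

Consequence for the census of the rung `(n, s)` (with `…SpaceCriterion`): a curvilinear local piece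
of dimension `r` costs `r - 1` equations (its lower jets) and contributes `≤ 2rn` to the rank, so EVERY
decomposition type of an `(n, s)`-witness into curvilinear pieces needs exactly a good `(s+1)`-space
with threshold `2sn` — for `(n, 3)`: one good `4`-space with threshold `6n` covers `ℂ³`,
`ℂ × ℂ[ε]/ε²` and `ℂ[ε]/ε³` alike.  HONEST FRAMING: a rank count; no stub of the line is closed and
VP ≠ VNP is not moved.

References: T. Mignon, N. Ressayre, IMRN 2004:79, §2 [MignonRessayre2004]; J. M. Landsberg,
*Geometry and Complexity Theory* (2017), Ex. 6.4.5.2 [LandsbergGCT2017].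
-/

noncomputable section

open MvPolynomial Matrix
open Literature.Computability.AlgebraicComplexity

-- single-conjunct layout `Summits/ValiantsHypothesis/ValiantsHypothesis`: duplicated namespace by design
set_option linter.dupNamespace false

namespace Summit.ValiantsHypothesis.ValiantsHypothesis.Theorems.GrenetZeonPolySizeQPAlgebra

open Summit.ValiantsHypothesis.ValiantsHypothesis.Theorems.GrenetZeonTwoDimCoefficients
  (rank_add_le rank_hess0_mul_le_two)

/-! ### Laplace along a row, through the adjugate, and the shift identity over `S[t]` -/

section Shift

variable {T : Type*} [CommRing T] {m : ℕ}

/-- The column `i₀` of the adjugate does not see the row `i₀`. [folklore] -/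
theorem adjugate_updateRow_apply_self (N : Matrix (Fin m) (Fin m) T) (i₀ k : Fin m) (v : Fin m → T) :
    (N.updateRow i₀ v).adjugate k i₀ = N.adjugate k i₀ := by
  rw [adjugate_apply, adjugate_apply]
  congr 1
  ext i j
  by_cases hi : i = i₀
  · subst hi; simp only [updateRow_self]
  · simp only [updateRow_ne hi]

/-- Laplace expansion along the row `i₀` through the adjugate: `det N = Σ_k N_{i₀k} adj(N)_{k i₀}`
(the `(i₀, i₀)` entry of `N · adj N = det N · 1`). [folklore] -/
theorem det_eq_sum_row_mul_adjugate (N : Matrix (Fin m) (Fin m) T) (i₀ : Fin m) :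
    N.det = ∑ k, N i₀ k * N.adjugate k i₀ := by
  have h := congr_fun (congr_fun (Matrix.mul_adjugate N) i₀) i₀
  rw [Matrix.mul_apply, Matrix.smul_apply, Matrix.one_apply_eq, smul_eq_mul, mul_one] at h
  exact h.symm

/-- Multilinearity in the row `i₀`: `det(N with row i₀ := v) = Σ_k v_k adj(N)_{k i₀}`. [folklore] -/
theorem det_updateRow_eq_sum_mul_adjugate (N : Matrix (Fin m) (Fin m) T) (i₀ : Fin m) (v : Fin m → T) :
    (N.updateRow i₀ v).det = ∑ k, v k * N.adjugate k i₀ := by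
  rw [det_eq_sum_row_mul_adjugate _ i₀]
  exact Finset.sum_congr rfl fun k _ => by rw [updateRow_self, adjugate_updateRow_apply_self]

variable {S : Type*} [CommRing S]

/-- **Shift identity.** For a square matrix `N` over `S[t]` and a row `i₀`, writing
`N_{i₀k} = a_k + t · N'_{i₀k}` (`a_k` the constant coefficient, `N' = divX`):
`det N = Σ_k a_k · adj(N)_{k i₀} + t · det B` with `B` = `N` with row `i₀` replaced by `N'_{i₀}`.
[folklore] -/
theorem det_eq_sum_C_coeff_zero_mul_adjugate_add_X_mul (N : Matrix (Fin m) (Fin m) (Polynomial S))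
    (i₀ : Fin m) :
    N.det = ∑ k, Polynomial.C ((N i₀ k).coeff 0) * N.adjugate k i₀ +
      Polynomial.X * (N.updateRow i₀ fun k => Polynomial.divX (N i₀ k)).det := by
  rw [det_updateRow_eq_sum_mul_adjugate, Finset.mul_sum, ← Finset.sum_add_distrib,
    det_eq_sum_row_mul_adjugate N i₀]
  refine Finset.sum_congr rfl fun k _ => ?_
  rw [← mul_assoc, ← add_mul]
  congr 1
  rw [add_comm, Polynomial.X_mul_divX_add]

/-- Coefficients of the shift identity: `[t^j] det N = Σ_k a_k · [t^j] adj(N)_{k i₀} + [t^j](t · det B)`.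
[folklore] -/
theorem coeff_det_eq_row_expansion (N : Matrix (Fin m) (Fin m) (Polynomial S)) (i₀ : Fin m) (j : ℕ) :
    N.det.coeff j = ∑ k, (N i₀ k).coeff 0 * (N.adjugate k i₀).coeff j +
      (Polynomial.X * (N.updateRow i₀ fun k => Polynomial.divX (N i₀ k)).det).coeff j := by
  conv_lhs => rw [det_eq_sum_C_coeff_zero_mul_adjugate_add_X_mul N i₀]
  rw [Polynomial.coeff_add, Polynomial.finsetSum_coeff]
  refine congrArg₂ (· + ·) (Finset.sum_congr rfl fun k _ => ?_) rfl
  rw [Polynomial.coeff_C_mul]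

end Shift

/-! ### The jet form and its row expansion -/

section Jet

variable {K : Type*} [Field K] {σ : Type*}

/-- **Row expansion of the jet form.** With `a_k = [t^0] M_{i₀k}`, `B` = `M` with row `i₀` replaced by
`divX M_{i₀}`:
`Σ_{j<r+1} λ_j [t^j] det M = Σ_k a_k Ψ_k + Σ_{j<r} λ_{j+1} [t^j] det B`
(`Ψ_k = Σ_{j<r+1} λ_j [t^j] adj(M)_{k i₀}`): the jets of `M` are those of `B` shifted by one, up to
multiples of the `a_k`. [folklore] -/
theorem jet_row_expansion {m : ℕ} (M : Matrix (Fin m) (Fin m) (Polynomial (MvPolynomial σ K)))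
    (w : ℕ → K) (i₀ : Fin m) (r : ℕ) :
    ∑ j ∈ Finset.range (r + 1), C (w j) * M.det.coeff j =
      ∑ k, (M i₀ k).coeff 0 *
          (∑ j ∈ Finset.range (r + 1), C (w j) * (M.adjugate k i₀).coeff j) +
        ∑ j ∈ Finset.range r, C (w (j + 1)) *
          (M.updateRow i₀ fun k => Polynomial.divX (M i₀ k)).det.coeff j := by
  set B := M.updateRow i₀ fun k => Polynomial.divX (M i₀ k) with hB
  have h1 : ∀ j, C (w j) * M.det.coeff j =
      ∑ k, (M i₀ k).coeff 0 * (C (w j) * (M.adjugate k i₀).coeff j) +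
        C (w j) * (Polynomial.X * B.det).coeff j := by
    intro j
    rw [coeff_det_eq_row_expansion M i₀ j, mul_add, Finset.mul_sum]
    exact congrArg₂ (· + ·) (Finset.sum_congr rfl fun k _ => by ring) rfl
  rw [Finset.sum_congr rfl fun j _ => h1 j, Finset.sum_add_distrib, Finset.sum_comm]
  refine congrArg₂ (· + ·) (Finset.sum_congr rfl fun k _ => by rw [Finset.mul_sum]) ?_
  rw [Finset.sum_range_succ', Polynomial.coeff_X_mul_zero, mul_zero, add_zero]
  exact Finset.sum_congr rfl fun j _ => by rw [Polynomial.coeff_X_mul]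

variable [Fintype σ]

/-- **Induction step, row form.** If the bound `(r) · 2m` holds for all jet forms of order `r`, and
`M` has affine coefficients, row `i₀` of `[t^0] M` vanishing at the origin, jets `D_0, …, D_{r-1}`
vanishing at the origin and `f = Σ_{j<r+1} λ_j D_j` vanishing at the origin, then
`rank Hess f(0) ≤ (r+1) · 2m`. [cite: MignonRessayre2004, §2] -/
theorem rank_hess0_jet_le_of_row {m r : ℕ}
    (ih : ∀ (M' : Matrix (Fin m) (Fin m) (Polynomial (MvPolynomial σ K))) (w' : ℕ → K),
      (∀ i k a, ((M' i k).coeff a).totalDegree ≤ 1) →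
      (∀ j, j + 2 ≤ r → constantCoeff (M'.det.coeff j) = 0) →
      constantCoeff (∑ j ∈ Finset.range r, C (w' j) * M'.det.coeff j) = 0 →
      (hess0 (∑ j ∈ Finset.range r, C (w' j) * M'.det.coeff j)).rank ≤ r * (2 * m))
    (M : Matrix (Fin m) (Fin m) (Polynomial (MvPolynomial σ K))) (w : ℕ → K) (i₀ : Fin m)
    (haff : ∀ i k a, ((M i k).coeff a).totalDegree ≤ 1)
    (hrow : ∀ k, constantCoeff ((M i₀ k).coeff 0) = 0)
    (hvan : ∀ j, j + 2 ≤ r + 1 → constantCoeff (M.det.coeff j) = 0)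
    (hf : constantCoeff (∑ j ∈ Finset.range (r + 1), C (w j) * M.det.coeff j) = 0) :
    (hess0 (∑ j ∈ Finset.range (r + 1), C (w j) * M.det.coeff j)).rank ≤ (r + 1) * (2 * m) := by
  classical
  set B := M.updateRow i₀ fun k => Polynomial.divX (M i₀ k) with hB
  set Ψ : Fin m → MvPolynomial σ K := fun k =>
    ∑ j ∈ Finset.range (r + 1), C (w j) * (M.adjugate k i₀).coeff j with hΨ
  set fB : MvPolynomial σ K := ∑ j ∈ Finset.range r, C (w (j + 1)) * B.det.coeff j with hfB
  have hsplit : ∑ j ∈ Finset.range (r + 1), C (w j) * M.det.coeff j =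
      ∑ k, (M i₀ k).coeff 0 * Ψ k + fB := jet_row_expansion M w i₀ r
  -- the row part vanishes at the origin and has Hessian rank `≤ 2m`
  have hg0 : constantCoeff (∑ k, (M i₀ k).coeff 0 * Ψ k) = 0 := by
    rw [map_sum]
    exact Finset.sum_eq_zero fun k _ => by rw [map_mul, hrow k, zero_mul]
  have hgrank : (hess0 (∑ k, (M i₀ k).coeff 0 * Ψ k)).rank ≤ 2 * m := by
    rw [map_sum]
    refine (rank_sum_le _ _).trans ?_
    refine (Finset.sum_le_sum fun k _ => rank_hess0_mul_le_two (haff i₀ k 0) (hrow k)).trans ?_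
    simp [mul_comm]
  -- the shifted matrix `B` satisfies the hypotheses of order `r`
  have hBaff : ∀ i k a, ((B i k).coeff a).totalDegree ≤ 1 := by
    intro i k a
    by_cases hi : i = i₀
    · subst hi
      rw [hB, updateRow_self, Polynomial.coeff_divX]
      exact haff _ k (a + 1)
    · rw [hB, updateRow_ne hi]
      exact haff i k a
  have hBcoeff : ∀ j, constantCoeff (B.det.coeff j) = constantCoeff (M.det.coeff (j + 1)) := by
    intro j
    rw [coeff_det_eq_row_expansion M i₀ (j + 1), Polynomial.coeff_X_mul, map_add, map_sum,
      Finset.sum_eq_zero fun k _ => by rw [map_mul, hrow k, zero_mul], zero_add]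
  have hBvan : ∀ j, j + 2 ≤ r → constantCoeff (B.det.coeff j) = 0 := fun j hj => by
    rw [hBcoeff]
    exact hvan (j + 1) (by omega)
  have hfB0 : constantCoeff fB = 0 := by
    have h := hf
    rw [hsplit, map_add, hg0, zero_add] at h
    exact h
  have hBrank := ih B (fun j => w (j + 1)) hBaff hBvan hfB0
  rw [hsplit, map_add]
  refine (rank_add_le _ _).trans ?_
  calc (hess0 (∑ k, (M i₀ k).coeff 0 * Ψ k)).rank + (hess0 fB).rank
      ≤ 2 * m + r * (2 * m) := Nat.add_le_add hgrank hBrank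
    _ = (r + 1) * (2 * m) := by ring

/-- **Induction step.** The row form after left-normalisation: if `D_0 = det A₀` vanishes at the
origin, an invertible constant matrix `V` with a left null vector of `A₀(0)` as row `i₀` makes row
`i₀` of `[t^0](V M)` vanish at the origin; all jets rescale by `det V ≠ 0`. [cite: MignonRessayre2004, §2] -/
theorem rank_hess0_jet_le_of_ih {m r : ℕ}
    (ih : ∀ (M' : Matrix (Fin m) (Fin m) (Polynomial (MvPolynomial σ K))) (w' : ℕ → K),
      (∀ i k a, ((M' i k).coeff a).totalDegree ≤ 1) →
      (∀ j, j + 2 ≤ r → constantCoeff (M'.det.coeff j) = 0) →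
      constantCoeff (∑ j ∈ Finset.range r, C (w' j) * M'.det.coeff j) = 0 →
      (hess0 (∑ j ∈ Finset.range r, C (w' j) * M'.det.coeff j)).rank ≤ r * (2 * m))
    (M : Matrix (Fin m) (Fin m) (Polynomial (MvPolynomial σ K))) (w : ℕ → K)
    (haff : ∀ i k a, ((M i k).coeff a).totalDegree ≤ 1)
    (hvan : ∀ j, j + 2 ≤ r + 1 → constantCoeff (M.det.coeff j) = 0)
    (h0 : constantCoeff (M.det.coeff 0) = 0)
    (hf : constantCoeff (∑ j ∈ Finset.range (r + 1), C (w j) * M.det.coeff j) = 0) :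
    (hess0 (∑ j ∈ Finset.range (r + 1), C (w j) * M.det.coeff j)).rank ≤ (r + 1) * (2 * m) := by
  classical
  cases m with
  | zero =>
      exfalso
      rw [Matrix.det_isEmpty, Polynomial.coeff_one_zero, map_one] at h0
      exact one_ne_zero h0
  | succ n =>
    -- the constant part of the constant coefficient matrix, and a left null vector
    set ψ : Polynomial (MvPolynomial σ K) →+* K :=
      (constantCoeff : MvPolynomial σ K →+* K).comp Polynomial.constantCoeff with hψ
    set Λ : Matrix (Fin (n + 1)) (Fin (n + 1)) K := M.map ψ with hΛ
    have hΛdet : Λ.det = 0 := by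
      rw [hΛ, ← RingHom.mapMatrix_apply, ← RingHom.map_det, hψ, RingHom.comp_apply,
        Polynomial.constantCoeff_apply, h0]
    obtain ⟨c, hc0, hcΛ⟩ := Matrix.exists_vecMul_eq_zero_iff.mpr hΛdet
    obtain ⟨i₀, hi₀⟩ := Function.ne_iff.mp hc0
    set V : Matrix (Fin (n + 1)) (Fin (n + 1)) K := (1 : Matrix _ _ K).updateRow i₀ c with hV
    have hVdet : V.det = c i₀ := by
      have hc : c = ∑ l, c l • (1 : Matrix (Fin (n + 1)) (Fin (n + 1)) K) l := by
        ext j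
        simp [Finset.sum_apply, Matrix.one_apply]
      rw [hV]
      conv_lhs => rw [hc]
      rw [Matrix.det_updateRow_sum, Matrix.det_one, smul_eq_mul, mul_one]
    set φ : K →+* Polynomial (MvPolynomial σ K) :=
      (Polynomial.C : MvPolynomial σ K →+* _).comp (C : K →+* MvPolynomial σ K) with hφ
    set VC : Matrix (Fin (n + 1)) (Fin (n + 1)) (Polynomial (MvPolynomial σ K)) := V.map φ with hVC
    have hVCdet : VC.det = φ V.det := by
      rw [hVC, ← RingHom.mapMatrix_apply, ← RingHom.map_det]
    set M' : Matrix (Fin (n + 1)) (Fin (n + 1)) (Polynomial (MvPolynomial σ K)) := VC * M with hM'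
    have hentry : ∀ i k a, (M' i k).coeff a = ∑ l, C (V i l) * (M l k).coeff a := by
      intro i k a
      rw [hM', Matrix.mul_apply, Polynomial.finsetSum_coeff]
      refine Finset.sum_congr rfl fun l _ => ?_
      rw [hVC, Matrix.map_apply, hφ, RingHom.comp_apply, Polynomial.coeff_C_mul]
    have hcoeffM' : ∀ j, M'.det.coeff j = C V.det * M.det.coeff j := by
      intro j
      rw [hM', Matrix.det_mul, hVCdet, hφ, RingHom.comp_apply, Polynomial.coeff_C_mul]
    have haff' : ∀ i k a, ((M' i k).coeff a).totalDegree ≤ 1 := by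
      intro i k a
      rw [hentry]
      refine totalDegree_finsetSum_le fun l _ => (totalDegree_mul _ _).trans ?_
      rw [totalDegree_C, zero_add]
      exact haff l k a
    have hrow' : ∀ k, constantCoeff ((M' i₀ k).coeff 0) = 0 := by
      intro k
      have h := congrFun hcΛ k
      change ∑ l, c l * Λ l k = 0 at h
      rw [hentry, map_sum]
      simp only [map_mul, constantCoeff_C, hV, Matrix.updateRow_self]
      simpa [hΛ, hψ] using h
    have hjet' : ∑ j ∈ Finset.range (r + 1), C (w j) * M'.det.coeff j =
        C V.det * ∑ j ∈ Finset.range (r + 1), C (w j) * M.det.coeff j := by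
      rw [Finset.mul_sum]
      exact Finset.sum_congr rfl fun j _ => by rw [hcoeffM']; ring
    have hvan' : ∀ j, j + 2 ≤ r + 1 → constantCoeff (M'.det.coeff j) = 0 := fun j hj => by
      rw [hcoeffM', map_mul, hvan j hj, mul_zero]
    have hf' : constantCoeff (∑ j ∈ Finset.range (r + 1), C (w j) * M'.det.coeff j) = 0 := by
      rw [hjet', map_mul, hf, mul_zero]
    have key := rank_hess0_jet_le_of_row ih M' w i₀ haff' hrow' hvan' hf'
    rwa [hjet', hess0_C_mul, rank_smul_eq (by rw [hVdet]; exact hi₀)] at key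

/-- **Jet Hessian bound.** Let `M` be an `m × m` matrix over `S[t]` (`S = K[x_σ]`) all of whose
coefficient matrices `A_a = [t^a] M` have affine entries, and let `D_j = [t^j] det M` be the jets of
its determinant.  If `D_0, …, D_{r-2}` vanish at the origin and the jet form `f = Σ_{j<r} λ_j D_j`
vanishes at the origin, then `rank Hess f(0) ≤ r · 2m`.  (`r = 1`: Mignon–Ressayre's `2m`;
`r = 2`: `4m` for `λ₀ det A₀ + λ₁ tr(adj A₀ · A₁)`; `r = 3`: `6m` for the type `K[ε]/ε³`.)
[cite: MignonRessayre2004, §2] -/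
theorem rank_hess0_jet_le {m : ℕ} (r : ℕ) :
    ∀ (M : Matrix (Fin m) (Fin m) (Polynomial (MvPolynomial σ K))) (w : ℕ → K),
      (∀ i k a, ((M i k).coeff a).totalDegree ≤ 1) →
      (∀ j, j + 2 ≤ r → constantCoeff (M.det.coeff j) = 0) →
      constantCoeff (∑ j ∈ Finset.range r, C (w j) * M.det.coeff j) = 0 →
      (hess0 (∑ j ∈ Finset.range r, C (w j) * M.det.coeff j)).rank ≤ r * (2 * m) := by
  classical
  induction r with
  | zero =>
      intro M w _ _ _
      rw [Finset.range_zero, Finset.sum_empty, map_zero, Matrix.rank_zero]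
      exact Nat.zero_le _
  | succ r ih =>
    intro M w haff hvan hf
    cases r with
    | zero =>
      -- `f = λ₀ det A₀`
      have hA0 : M.det.coeff 0 = (M.map fun q : Polynomial (MvPolynomial σ K) => q.coeff 0).det := by
        rw [← Polynomial.constantCoeff_apply, RingHom.map_det, RingHom.mapMatrix_apply]
        rfl
      rw [zero_add, Finset.range_one, Finset.sum_singleton] at hf ⊢
      rw [hess0_C_mul]
      by_cases hw : w 0 = 0
      · rw [hw, zero_smul, Matrix.rank_zero]
        exact Nat.zero_le _
      · rw [rank_smul_eq hw, hA0]
        have hdet0 : constantCoeff (M.map fun q : Polynomial (MvPolynomial σ K) => q.coeff 0).det = 0 := by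
          rw [map_mul, constantCoeff_C, hA0] at hf
          exact (mul_eq_zero.1 hf).resolve_left hw
        calc (hess0 (M.map fun q : Polynomial (MvPolynomial σ K) => q.coeff 0).det).rank
            ≤ 2 * m := rank_hess0_det_le _ (fun i k => haff i k 0) hdet0
          _ = (0 + 1) * (2 * m) := by ring
    | succ r =>
      exact rank_hess0_jet_le_of_ih ih M w haff hvan (hvan 0 (by omega)) hf

/-- **Jet Hessian bound at a point.** Same as `rank_hess0_jet_le` at an arbitrary point `p`: if the
jets `D_0, …, D_{r-2}` of `det M` and the jet form `f = Σ_{j<r} λ_j D_j` vanish at `p`, then the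
Hessian of `f` at `p` has rank `≤ r · 2m` (translate by `p`: coefficients, determinants and jets
commute with the translation, which preserves affine entries). [cite: MignonRessayre2004, §2] -/
theorem rank_hess0_transl_jet_le {m : ℕ} (r : ℕ)
    (M : Matrix (Fin m) (Fin m) (Polynomial (MvPolynomial σ K))) (w : ℕ → K)
    (haff : ∀ i k a, ((M i k).coeff a).totalDegree ≤ 1) (p : σ → K)
    (hvan : ∀ j, j + 2 ≤ r → eval p (M.det.coeff j) = 0)
    (hf : eval p (∑ j ∈ Finset.range r, C (w j) * M.det.coeff j) = 0) :
    (hess0 (transl p (∑ j ∈ Finset.range r, C (w j) * M.det.coeff j))).rank ≤ r * (2 * m) := by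
  classical
  set τ : MvPolynomial σ K →+* MvPolynomial σ K := (transl p : MvPolynomial σ K →ₐ[K] _).toRingHom
    with hτ
  set M' : Matrix (Fin m) (Fin m) (Polynomial (MvPolynomial σ K)) := M.map (Polynomial.map τ) with hM'
  have hcoeff : ∀ j, transl p (M.det.coeff j) = M'.det.coeff j := by
    intro j
    rw [hM', ← Polynomial.coe_mapRingHom, ← RingHom.mapMatrix_apply, ← RingHom.map_det,
      Polynomial.coe_mapRingHom, Polynomial.coeff_map]
    rfl
  have hjet : transl p (∑ j ∈ Finset.range r, C (w j) * M.det.coeff j) =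
      ∑ j ∈ Finset.range r, C (w j) * M'.det.coeff j := by
    rw [map_sum]
    exact Finset.sum_congr rfl fun j _ => by rw [map_mul, transl_C, hcoeff]
  rw [hjet]
  refine rank_hess0_jet_le r M' w (fun i k a => ?_) (fun j hj => ?_) ?_
  · rw [hM', Matrix.map_apply, Polynomial.coeff_map]
    exact (totalDegree_transl_le p _).trans (haff i k a)
  · rw [← hcoeff, constantCoeff_transl]
    exact hvan j hj
  · rw [← hjet, constantCoeff_transl]
    exact hf

end Jet

end Summit.ValiantsHypothesis.ValiantsHypothesis.Theorems.GrenetZeonPolySizeQPAlgebra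

end
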